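import Literature.NumberTheory.LFunctions.NoRealZeroSmallModuli
import Literature.Barriers.RiemannHypothesis.EpsteinZetaRealZerosSmallK
import HarnessLib

/-!
# No real zero for the real primitive characters of modulus `≤ 52`, in the kernel
# (`NoRealZeroUpTo 52`, unconditionally)

Topic `Literature/NumberTheory/LFunctions`; namespace `Literature.NumberTheory.LFunctions`
(helpers in `Literature.NumberTheory.LFunctions.SmallModuliII`). THEOREMS only (no definition, no named
fact, no `sorry`): the kernel base of the certified no-exceptional-zero tables is extended from `23`
(`noRealZeroUpTo_twentyThree`, `NoRealZeroSmallModuli.lean`) to `52`: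
**`noRealZeroUpTo_fiftyTwo : NoRealZeroUpTo 52`** — for every modulus `3 ≤ q ≤ 52`, every primitive
quadratic `χ` mod `q` and every `σ ∈ (0, 1)`, `L(σ, χ) ≠ 0`; hence `NoExceptionalZeroUpTo 52 c` for
every `c` (`noExceptionalZeroUpTo_fiftyTwo`). The seventeen new characters are the Kronecker symbols
of `d = ±24, 28, 29, −31, 33, −35, 37, −39, ±40, 41, −43, 44, −47, −51, −52`; the moduli
`25, 26, 27, 30, 32, 34, 36, 38, 42, 45, 46, 48, 49, 50` carry no primitive quadratic character.

Why `52`: Fekete–Pólya positivity of order `≤ 2` (MV §11.2.1 Exercise 7: `S₁ ≥ 0` or `S₂ ≥ 0` over one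
period forces `L(σ, χ) > 0` on `(0, ∞)`) holds for every fundamental discriminant `24 ≤ |d| ≤ 52`
EXCEPT `d = −43` (`S₂(5) = −1`), and fails first among even characters at `d = 53`; the gap `d = −43`
is closed by the tree's Epstein class-sum theorem
`Literature.Barriers.RiemannHypothesis.LFunction_ne_zero_of_odd_quadratic_of_le` (odd conductors
`4 < d ≤ 144`: every reduced class of discriminant `−d` has `k ≤ 6`). Purpose: these small conductors
are the DEEPEST rows of the Lu–Zaman–Zhao prime-sum certificates (arXiv:2602.03626, §3: `d = 24`
needs the primes up to `8.2·10⁶`, `29` up to `6.4·10⁶`, `28` up to `4.5·10⁶`, `33`, `37` up to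
`2.4·10⁶`), far beyond any kernel-verified prime table; with this base the kernel replay of the
certificates (`NoRealZeroCertificateReplay*.lean`) may start at `|D| > 52`.

Method (as in `NoRealZeroSmallModuli.lean`, engine `FeketePolyaTables.lean`): identify the values of the
ABSTRACT primitive quadratic character mod `q` with a period table — `(·/q)` for odd squarefree `q`
(`SmallModuli.apply_eq_tableVal_of_jacobi`), `χ₋₄(·)(·/m)` for `q = 4m`
(`SmallModuli.apply_eq_tableVal_four_mul`), and, NEW here, `χ_{∓8}(·)(·/m)` for `q = 8m`
(`apply_eq_tableVal_eight_mul`, two characters per modulus) — verify the tables residue by residue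
(`norm_num` Jacobi evaluation) and check `S₁ ≥ 0` (order one: `d = −24, −31, −35, −39, −40, −47`) or
`S₂ ≥ 0` with drift (order two: `d = 24, 28, 29, 33, 37, 40, 41, 44, −51, −52`) over one period by `decide`.

## References

* H. L. Montgomery, R. C. Vaughan, *Multiplicative Number Theory I*, CUP 2007, §11.2.1 Exercise 7,
  §9.3 Theorem 9.13 and Lemma 9.3. [MontgomeryVaughan2007]
* J. B. Rosser, *Real roots of real Dirichlet L-series*, J. Research Nat. Bur. Standards 45 (1950)
  505–514. [Rosser1950RealRoots]
* P. T. Bateman, E. Grosswald, *On Epstein's zeta function*, Acta Arith. 9 (1964) 365–373,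
  Theorem 3. [BatemanGrosswald1964]
-/

namespace Literature.NumberTheory.LFunctions

namespace SmallModuliII

open PrimitiveQuadratic FeketePolyaTable SmallModuli Literature.Barriers.RiemannHypothesis
open scoped NumberTheorySymbols

/-- Primitive characters of modulus `≥ 2` are non-trivial. [folklore] -/
private theorem ne_one {q : ℕ} [NeZero q] {χ : DirichletCharacter ℂ q} (hprim : χ.IsPrimitive)
    (hq : 2 ≤ q) : χ ≠ 1 :=
  SiegelZeroQuality.ne_one_of_isPrimitive hprim hq

/-- Odd squarefree modulus, order one. [cite: MontgomeryVaughan2007, §11.2.1 Exercise 7] -/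
private theorem good_of_jacobi_one {q : ℕ} [NeZero q] (hodd : Odd q) (hq : 2 ≤ q) (l : List ℤ)
    (hlen : l.length = q) (htab : ∀ k : ℕ, k < q → jacobiSym k q = tableVal l k)
    (h0 : psum l l.length = 0) (hchk : ∀ N, N ≤ l.length → 0 ≤ psum l N) :
    ∀ χ : DirichletCharacter ℂ q, χ.IsQuadratic → χ.IsPrimitive →
      ∀ σ : ℝ, 0 < σ → σ < 1 → χ.LFunction σ ≠ 0 := by
  intro χ hquad hprim σ hσ _
  exact lfunction_ne_zero_of_table_one l χ (ne_one hprim hq) (by rw [hlen]; omega)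
    (apply_eq_tableVal_of_jacobi hodd hprim hquad l hlen htab) h0 hchk hσ

/-- Odd squarefree modulus, order two (drift allowed). [cite: MontgomeryVaughan2007, §11.2.1 Exercise 7] -/
private theorem good_of_jacobi_two {q : ℕ} [NeZero q] (hodd : Odd q) (hq : 2 ≤ q) (l : List ℤ)
    (hlen : l.length = q) (htab : ∀ k : ℕ, k < q → jacobiSym k q = tableVal l k)
    (h0 : psum l l.length = 0) (h2 : 0 ≤ psum2 l l.length)
    (hchk : ∀ N, N ≤ l.length → 0 ≤ psum2 l N) :
    ∀ χ : DirichletCharacter ℂ q, χ.IsQuadratic → χ.IsPrimitive →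
      ∀ σ : ℝ, 0 < σ → σ < 1 → χ.LFunction σ ≠ 0 := by
  intro χ hquad hprim σ hσ _
  exact lfunction_ne_zero_of_table_two' l χ (ne_one hprim hq) (by rw [hlen]; omega)
    (apply_eq_tableVal_of_jacobi hodd hprim hquad l hlen htab) h0 h2 hchk hσ

/-- **Modulus `8m`, `m` odd** (CRT): the values of a primitive quadratic character mod `8m` are
`χ₂(n) · (n/m)` with `χ₂` primitive quadratic mod `8`, i.e. `χ₂ = χ₋₈ = (0,1,0,1,0,−1,0,−1)` or
`χ₂ = χ₈ = (0,1,0,−1,0,−1,0,1)` (by the value at `3`); so they are those of one of two `8m`-periodic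
tables agreeing with these products on the residues. [cite: MontgomeryVaughan2007, Lemma 9.3 and Theorem 9.13] -/
theorem apply_eq_tableVal_eight_mul {m : ℕ} [NeZero m] (hm : Odd m)
    {χ : DirichletCharacter ℂ (2 ^ 3 * m)} (hprim : χ.IsPrimitive) (hquad : χ.IsQuadratic)
    (lA lB : List ℤ) (hlenA : lA.length = 2 ^ 3 * m) (hlenB : lB.length = 2 ^ 3 * m)
    (htabA : ∀ k : ℕ, k < 2 ^ 3 * m →
      tableVal [0, 1, 0, 1, 0, -1, 0, -1] k * jacobiSym k m = tableVal lA k)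
    (htabB : ∀ k : ℕ, k < 2 ^ 3 * m →
      tableVal [0, 1, 0, -1, 0, -1, 0, 1] k * jacobiSym k m = tableVal lB k) :
    (∀ n : ℕ, χ (n : ZMod (2 ^ 3 * m)) = ((tableVal lA n : ℤ) : ℂ)) ∨
      (∀ n : ℕ, χ (n : ZMod (2 ^ 3 * m)) = ((tableVal lB n : ℤ) : ℂ)) := by
  have hcop := coprime_two_pow_of_odd 3 hm
  have hq0 : 0 < 2 ^ 3 * m := NeZero.pos _
  -- reduction of both kinds of table to the residue `n % (8m)`
  have h8 : ∀ (T : List ℤ), T.length = 8 → ∀ n : ℕ, tableVal T n = tableVal T (n % (2 ^ 3 * m)) := by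
    intro T hT n
    unfold tableVal
    rw [hT, Nat.mod_mod_of_dvd n (Dvd.intro _ rfl : (8 : ℕ) ∣ 2 ^ 3 * m)]
  have hJ : ∀ n : ℕ, jacobiSym (n : ℤ) m = jacobiSym ((n % (2 ^ 3 * m) : ℕ) : ℤ) m := by
    intro n
    rw [jacobiSym.mod_left (n : ℤ) m, jacobiSym.mod_left ((n % (2 ^ 3 * m) : ℕ) : ℤ) m]
    congr 1
    push_cast
    exact (Int.emod_emod_of_dvd _ (Dvd.intro_left _ rfl : (m : ℤ) ∣ 8 * m)).symm
  have hL : ∀ (l : List ℤ), l.length = 2 ^ 3 * m → ∀ n : ℕ, tableVal l n = tableVal l (n % (2 ^ 3 * m)) := by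
    intro l hl n
    unfold tableVal; rw [hl, Nat.mod_mod]
  rcases apply_eq_tableVal_eight (isPrimitive_crtFst hcop hprim) (IsQuadratic.crtFst hcop hquad) with
    ⟨-, hv⟩ | ⟨-, hv⟩
  · left
    intro n
    rw [apply_natCast_eq_crtFst_mul_jacobiSym hm hprim hquad n, hv n, ← Int.cast_mul]
    congr 1
    rw [h8 _ rfl n, hJ n, hL lA hlenA n]
    exact htabA _ (Nat.mod_lt n hq0)
  · right
    intro n
    rw [apply_natCast_eq_crtFst_mul_jacobiSym hm hprim hquad n, hv n, ← Int.cast_mul]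
    congr 1
    rw [h8 _ rfl n, hJ n, hL lB hlenB n]
    exact htabB _ (Nat.mod_lt n hq0)

/-- `d = 24` and `d = -24`, modulus `8·3` (the two primitive quadratic characters, by the value at `3` of
the mod-`8` component). [cite: MontgomeryVaughan2007, §11.2.1 Exercise 7] -/
private theorem good24 :
    ∀ χ : DirichletCharacter ℂ (2 ^ 3 * 3), χ.IsQuadratic → χ.IsPrimitive →
      ∀ σ : ℝ, 0 < σ → σ < 1 → χ.LFunction σ ≠ 0 := by
  intro χ hquad hprim σ hσ _
  rcases apply_eq_tableVal_eight_mul (by decide) hprim hquad [0, 1, 0, 0, 0, 1, 0, -1, 0, 0, 0, -1, 0, -1, 0, 0, 0, -1, 0, 1, 0, 0, 0, 1] [0, 1, 0, 0, 0, 1, 0, 1, 0, 0, 0, 1, 0, -1, 0, 0, 0, -1, 0, -1, 0, 0, 0, -1] rfl rfl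
      (by intro k hk; interval_cases k <;> norm_num <;> decide)
      (by intro k hk; interval_cases k <;> norm_num <;> decide) with hv | hv
  · exact lfunction_ne_zero_of_table_two' [0, 1, 0, 0, 0, 1, 0, -1, 0, 0, 0, -1, 0, -1, 0, 0, 0, -1, 0, 1, 0, 0, 0, 1] χ (ne_one hprim (by norm_num)) (by decide) hv
      (by decide) (by decide) (by decide) hσ
  · exact lfunction_ne_zero_of_table_one [0, 1, 0, 0, 0, 1, 0, 1, 0, 0, 0, 1, 0, -1, 0, 0, 0, -1, 0, -1, 0, 0, 0, -1] χ (ne_one hprim (by norm_num)) (by decide) hv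
      (by decide) (by decide) hσ

/-- `d = 28`, modulus `4·7` (order two). [cite: MontgomeryVaughan2007, §11.2.1 Exercise 7] -/
private theorem good28 :
    ∀ χ : DirichletCharacter ℂ (2 ^ 2 * 7), χ.IsQuadratic → χ.IsPrimitive →
      ∀ σ : ℝ, 0 < σ → σ < 1 → χ.LFunction σ ≠ 0 := by
  intro χ hquad hprim σ hσ _
  exact lfunction_ne_zero_of_table_two' [0, 1, 0, 1, 0, -1, 0, 0, 0, 1, 0, -1, 0, -1, 0, -1, 0, -1, 0, 1, 0, 0, 0, -1, 0, 1, 0, 1] χ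
    (ne_one hprim (by norm_num)) (by decide)
    (apply_eq_tableVal_four_mul (by decide) hprim hquad _ rfl
      (by intro k hk; interval_cases k <;> norm_num <;> decide))
    (by decide) (by decide) (by decide) hσ

/-- `d = -40` and `d = 40`, modulus `8·5` (the two primitive quadratic characters, by the value at `3` of
the mod-`8` component). [cite: MontgomeryVaughan2007, §11.2.1 Exercise 7] -/
private theorem good40 :
    ∀ χ : DirichletCharacter ℂ (2 ^ 3 * 5), χ.IsQuadratic → χ.IsPrimitive →
      ∀ σ : ℝ, 0 < σ → σ < 1 → χ.LFunction σ ≠ 0 := by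
  intro χ hquad hprim σ hσ _
  rcases apply_eq_tableVal_eight_mul (by decide) hprim hquad [0, 1, 0, -1, 0, 0, 0, 1, 0, 1, 0, 1, 0, 1, 0, 0, 0, -1, 0, 1, 0, -1, 0, 1, 0, 0, 0, -1, 0, -1, 0, -1, 0, -1, 0, 0, 0, 1, 0, -1] [0, 1, 0, 1, 0, 0, 0, -1, 0, 1, 0, -1, 0, 1, 0, 0, 0, -1, 0, -1, 0, -1, 0, -1, 0, 0, 0, 1, 0, -1, 0, 1, 0, -1, 0, 0, 0, 1, 0, 1] rfl rfl
      (by intro k hk; interval_cases k <;> norm_num <;> decide)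
      (by intro k hk; interval_cases k <;> norm_num <;> decide) with hv | hv
  · exact lfunction_ne_zero_of_table_one [0, 1, 0, -1, 0, 0, 0, 1, 0, 1, 0, 1, 0, 1, 0, 0, 0, -1, 0, 1, 0, -1, 0, 1, 0, 0, 0, -1, 0, -1, 0, -1, 0, -1, 0, 0, 0, 1, 0, -1] χ (ne_one hprim (by norm_num)) (by decide) hv
      (by decide) (by decide) hσ
  · exact lfunction_ne_zero_of_table_two' [0, 1, 0, 1, 0, 0, 0, -1, 0, 1, 0, -1, 0, 1, 0, 0, 0, -1, 0, -1, 0, -1, 0, -1, 0, 0, 0, 1, 0, -1, 0, 1, 0, -1, 0, 0, 0, 1, 0, 1] χ (ne_one hprim (by norm_num)) (by decide) hv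
      (by decide) (by decide) (by decide) hσ

/-- `d = 44`, modulus `4·11` (order two). [cite: MontgomeryVaughan2007, §11.2.1 Exercise 7] -/
private theorem good44 :
    ∀ χ : DirichletCharacter ℂ (2 ^ 2 * 11), χ.IsQuadratic → χ.IsPrimitive →
      ∀ σ : ℝ, 0 < σ → σ < 1 → χ.LFunction σ ≠ 0 := by
  intro χ hquad hprim σ hσ _
  exact lfunction_ne_zero_of_table_two' [0, 1, 0, -1, 0, 1, 0, 1, 0, 1, 0, 0, 0, -1, 0, -1, 0, -1, 0, 1, 0, -1, 0, -1, 0, 1, 0, -1, 0, -1, 0, -1, 0, 0, 0, 1, 0, 1, 0, 1, 0, -1, 0, 1] χ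
    (ne_one hprim (by norm_num)) (by decide)
    (apply_eq_tableVal_four_mul (by decide) hprim hquad _ rfl
      (by intro k hk; interval_cases k <;> norm_num <;> decide))
    (by decide) (by decide) (by decide) hσ

/-- `d = -52`, modulus `4·13` (order two). [cite: MontgomeryVaughan2007, §11.2.1 Exercise 7] -/
private theorem good52 :
    ∀ χ : DirichletCharacter ℂ (2 ^ 2 * 13), χ.IsQuadratic → χ.IsPrimitive →
      ∀ σ : ℝ, 0 < σ → σ < 1 → χ.LFunction σ ≠ 0 := by
  intro χ hquad hprim σ hσ _
  exact lfunction_ne_zero_of_table_two' [0, 1, 0, -1, 0, -1, 0, 1, 0, 1, 0, 1, 0, 0, 0, 1, 0, 1, 0, 1, 0, -1, 0, -1, 0, 1, 0, -1, 0, 1, 0, 1, 0, -1, 0, -1, 0, -1, 0, 0, 0, -1, 0, -1, 0, -1, 0, 1, 0, 1, 0, -1] χ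
    (ne_one hprim (by norm_num)) (by decide)
    (apply_eq_tableVal_four_mul (by decide) hprim hquad _ rfl
      (by intro k hk; interval_cases k <;> norm_num <;> decide))
    (by decide) (by decide) (by decide) hσ

/-- **All primitive quadratic characters of a modulus `q ≡ 3 (mod 4)` are odd** (`χ(−1) q` is a
fundamental discriminant, and `+q ≡ 3 (mod 4)` is not). [cite: MontgomeryVaughan2007, Theorem 9.13] -/
theorem odd_of_mod_four_eq_three {q : ℕ} [NeZero q] (hq : q % 4 = 3) {χ : DirichletCharacter ℂ q}
    (hprim : χ.IsPrimitive) (hquad : χ.IsQuadratic) : χ.Odd := by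
  obtain ⟨s, hs1, hs⟩ := exists_sign_eq χ
  rcases hs1 with ⟨rfl, -⟩ | ⟨-, hod⟩
  · exfalso
    have h1 : 1 < q := by omega
    rcases isFundamentalDiscriminant_sign_mul hprim hquad hs (Or.inl rfl) h1 with ⟨h4, -, -⟩ | ⟨h4, -, -⟩
    · omega
    · omega
  · exact hod

/-- `d = −43` by the Epstein class sum (Fekete–Pólya fails here: `S₂(5) = −1`): every primitive
quadratic character mod `43` is odd and `43 ≤ 144`. [cite: BatemanGrosswald1964, Theorem 3] -/
private theorem good43 :
    ∀ χ : DirichletCharacter ℂ 43, χ.IsQuadratic → χ.IsPrimitive →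
      ∀ σ : ℝ, 0 < σ → σ < 1 → χ.LFunction σ ≠ 0 := by
  intro χ hquad hprim σ hσ0 hσ1
  exact LFunction_ne_zero_of_odd_quadratic_of_le (by norm_num) (by norm_num) hprim hquad
    (odd_of_mod_four_eq_three (by norm_num) hprim hquad) hσ0 hσ1

/-- Moduli `2m`, `m` odd: no primitive character. [cite: MontgomeryVaughan2007, Theorem 9.13] -/
private theorem good_two_mul {m : ℕ} [NeZero m] (hm : Odd m) :
    ∀ χ : DirichletCharacter ℂ (2 ^ 1 * m), χ.IsQuadratic → χ.IsPrimitive →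
      ∀ σ : ℝ, 0 < σ → σ < 1 → χ.LFunction σ ≠ 0 :=
  fun _ _ hprim ↦ (not_isPrimitive_two_mul hm hprim).elim

/-- Odd modulus with a square factor `p²`: no primitive quadratic character. [cite: MontgomeryVaughan2007, Theorem 9.13] -/
private theorem good_of_sq {q : ℕ} [NeZero q] (hodd : Odd q) {p : ℕ} (hp : 1 < p) (hpq : p * p ∣ q) :
    ∀ χ : DirichletCharacter ℂ q, χ.IsQuadratic → χ.IsPrimitive →
      ∀ σ : ℝ, 0 < σ → σ < 1 → χ.LFunction σ ≠ 0 := by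
  intro χ hquad hprim
  have h := squarefree_of_isPrimitive_of_isQuadratic hodd hprim hquad
  have hu := Nat.isUnit_iff.mp (h p hpq)
  omega

/-- Modulus `25 = 5²`. [cite: MontgomeryVaughan2007, Theorem 9.13] -/
private theorem good25 :
    ∀ χ : DirichletCharacter ℂ 25, χ.IsQuadratic → χ.IsPrimitive →
      ∀ σ : ℝ, 0 < σ → σ < 1 → χ.LFunction σ ≠ 0 :=
  good_of_sq (by decide) (p := 5) (by norm_num) (by norm_num)

/-- Modulus `27 = 3³`. [cite: MontgomeryVaughan2007, Theorem 9.13] -/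
private theorem good27 :
    ∀ χ : DirichletCharacter ℂ 27, χ.IsQuadratic → χ.IsPrimitive →
      ∀ σ : ℝ, 0 < σ → σ < 1 → χ.LFunction σ ≠ 0 :=
  good_of_sq (by decide) (p := 3) (by norm_num) (by norm_num)

/-- Modulus `45 = 3²·5`. [cite: MontgomeryVaughan2007, Theorem 9.13] -/
private theorem good45 :
    ∀ χ : DirichletCharacter ℂ 45, χ.IsQuadratic → χ.IsPrimitive →
      ∀ σ : ℝ, 0 < σ → σ < 1 → χ.LFunction σ ≠ 0 :=
  good_of_sq (by decide) (p := 3) (by norm_num) (by norm_num)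

/-- Modulus `49 = 7²`. [cite: MontgomeryVaughan2007, Theorem 9.13] -/
private theorem good49 :
    ∀ χ : DirichletCharacter ℂ 49, χ.IsQuadratic → χ.IsPrimitive →
      ∀ σ : ℝ, 0 < σ → σ < 1 → χ.LFunction σ ≠ 0 :=
  good_of_sq (by decide) (p := 7) (by norm_num) (by norm_num)

/-- Modulus `32 = 2⁵`: no primitive quadratic character. [cite: MontgomeryVaughan2007, Theorem 9.13] -/
private theorem good32 :
    ∀ χ : DirichletCharacter ℂ (2 ^ 5), χ.IsQuadratic → χ.IsPrimitive →
      ∀ σ : ℝ, 0 < σ → σ < 1 → χ.LFunction σ ≠ 0 := by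
  intro χ hquad hprim
  have := level_two_pow_le_three hprim hquad
  omega

/-- Modulus `36 = 4·9`, `9` not squarefree: no primitive quadratic character. [cite: MontgomeryVaughan2007, Theorem 9.13] -/
private theorem good36 :
    ∀ χ : DirichletCharacter ℂ (2 ^ 2 * 9), χ.IsQuadratic → χ.IsPrimitive →
      ∀ σ : ℝ, 0 < σ → σ < 1 → χ.LFunction σ ≠ 0 := by
  intro χ hquad hprim
  have h := squarefree_of_level_two_pow_mul (by decide : Odd 9) hprim hquad
  have hu := Nat.isUnit_iff.mp (h 3 (by norm_num))
  omega

/-- Modulus `48 = 2⁴·3`: no primitive quadratic character. [cite: MontgomeryVaughan2007, Theorem 9.13] -/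
private theorem good48 :
    ∀ χ : DirichletCharacter ℂ (2 ^ 4 * 3), χ.IsQuadratic → χ.IsPrimitive →
      ∀ σ : ℝ, 0 < σ → σ < 1 → χ.LFunction σ ≠ 0 := by
  intro χ hquad hprim
  have := le_three_of_level_two_pow_mul (by decide : Odd 3) hprim hquad
  omega

end SmallModuliII

open SmallModuli SmallModuliII in
/-- **`NoRealZeroUpTo 52`, unconditionally**: for every modulus `3 ≤ q ≤ 52`, every primitive quadratic
Dirichlet character `χ` mod `q` and every real `σ ∈ (0, 1)`, `L(σ, χ) ≠ 0`. (Moduli `≤ 23`: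
`noRealZeroUpTo_twentyThree`; `24 ≤ q ≤ 52`: Fekete–Pólya positivity of order one or two checked by
`decide` over one period, `d = −43` by the Epstein class sum, and the moduli carrying no primitive
quadratic character.) [cite: MontgomeryVaughan2007, §11.2.1 Exercise 7] -/
theorem noRealZeroUpTo_fiftyTwo : NoRealZeroUpTo 52 := by
  intro q _ hq3 hq52 χ hquad hprim σ hσ0 hσ1
  by_cases hq23 : q ≤ 23
  · exact noRealZeroUpTo_twentyThree q hq3 hq23 χ hquad hprim σ hσ0 hσ1
  have hq24 : 24 ≤ q := by omega
  interval_cases q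
  · exact good24 χ hquad hprim σ hσ0 hσ1
  · exact good25 χ hquad hprim σ hσ0 hσ1
  · exact good_two_mul (m := 13) (by decide) χ hquad hprim σ hσ0 hσ1
  · exact good27 χ hquad hprim σ hσ0 hσ1
  · exact good28 χ hquad hprim σ hσ0 hσ1
  · exact good_of_jacobi_two (q := 29) (by decide) (by norm_num)
      [0, 1, -1, -1, 1, 1, 1, 1, -1, 1, -1, -1, -1, 1, -1, -1, 1, -1, -1, -1, 1, -1, 1, 1, 1, 1, -1, -1, 1] rfl
      (by intro k hk; interval_cases k <;> norm_num <;> decide) (by decide) (by decide) (by decide)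
      χ hquad hprim σ hσ0 hσ1
  · exact good_two_mul (m := 15) (by decide) χ hquad hprim σ hσ0 hσ1
  · exact good_of_jacobi_one (q := 31) (by decide) (by norm_num)
      [0, 1, 1, -1, 1, 1, -1, 1, 1, 1, 1, -1, -1, -1, 1, -1, 1, -1, 1, 1, 1, -1, -1, -1, -1, 1, -1, -1, 1, -1, -1] rfl
      (by intro k hk; interval_cases k <;> norm_num <;> decide) (by decide) (by decide)
      χ hquad hprim σ hσ0 hσ1
  · exact good32 χ hquad hprim σ hσ0 hσ1
  · exact good_of_jacobi_two (q := 33) (by decide) (by norm_num)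
      [0, 1, 1, 0, 1, -1, 0, -1, 1, 0, -1, 0, 0, -1, -1, 0, 1, 1, 0, -1, -1, 0, 0, -1, 0, 1, -1, 0, -1, 1, 0, 1, 1] rfl
      (by intro k hk; interval_cases k <;> norm_num <;> decide) (by decide) (by decide) (by decide)
      χ hquad hprim σ hσ0 hσ1
  · exact good_two_mul (m := 17) (by decide) χ hquad hprim σ hσ0 hσ1
  · exact good_of_jacobi_one (q := 35) (by decide) (by norm_num)
      [0, 1, -1, 1, 1, 0, -1, 0, -1, 1, 0, 1, 1, 1, 0, 0, 1, 1, -1, -1, 0, 0, -1, -1, -1, 0, -1, 1, 0, 1, 0, -1, -1, 1, -1] rfl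
      (by intro k hk; interval_cases k <;> norm_num <;> decide) (by decide) (by decide)
      χ hquad hprim σ hσ0 hσ1
  · exact good36 χ hquad hprim σ hσ0 hσ1
  · exact good_of_jacobi_two (q := 37) (by decide) (by norm_num)
      [0, 1, -1, 1, 1, -1, -1, 1, -1, 1, 1, 1, 1, -1, -1, -1, 1, -1, -1, -1, -1, 1, -1, -1, -1, 1, 1, 1, 1, -1, 1, -1, -1, 1, 1, -1, 1] rfl
      (by intro k hk; interval_cases k <;> norm_num <;> decide) (by decide) (by decide) (by decide)
      χ hquad hprim σ hσ0 hσ1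
  · exact good_two_mul (m := 19) (by decide) χ hquad hprim σ hσ0 hσ1
  · exact good_of_jacobi_one (q := 39) (by decide) (by norm_num)
      [0, 1, 1, 0, 1, 1, 0, -1, 1, 0, 1, 1, 0, 0, -1, 0, 1, -1, 0, -1, 1, 0, 1, -1, 0, 1, 0, 0, -1, -1, 0, -1, 1, 0, -1, -1, 0, -1, -1] rfl
      (by intro k hk; interval_cases k <;> norm_num <;> decide) (by decide) (by decide)
      χ hquad hprim σ hσ0 hσ1
  · exact good40 χ hquad hprim σ hσ0 hσ1
  · exact good_of_jacobi_two (q := 41) (by decide) (by norm_num)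
      [0, 1, 1, -1, 1, 1, -1, -1, 1, 1, 1, -1, -1, -1, -1, -1, 1, -1, 1, -1, 1, 1, -1, 1, -1, 1, -1, -1, -1, -1, -1, 1, 1, 1, -1, -1, 1, 1, -1, 1, 1] rfl
      (by intro k hk; interval_cases k <;> norm_num <;> decide) (by decide) (by decide) (by decide)
      χ hquad hprim σ hσ0 hσ1
  · exact good_two_mul (m := 21) (by decide) χ hquad hprim σ hσ0 hσ1
  · exact good43 χ hquad hprim σ hσ0 hσ1
  · exact good44 χ hquad hprim σ hσ0 hσ1
  · exact good45 χ hquad hprim σ hσ0 hσ1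
  · exact good_two_mul (m := 23) (by decide) χ hquad hprim σ hσ0 hσ1
  · exact good_of_jacobi_one (q := 47) (by decide) (by norm_num)
      [0, 1, 1, 1, 1, -1, 1, 1, 1, 1, -1, -1, 1, -1, 1, -1, 1, 1, 1, -1, -1, 1, -1, -1, 1, 1, -1, 1, 1, -1, -1, -1, 1, -1, 1, -1, 1, 1, -1, -1, -1, -1, 1, -1, -1, -1, -1] rfl
      (by intro k hk; interval_cases k <;> norm_num <;> decide) (by decide) (by decide)
      χ hquad hprim σ hσ0 hσ1
  · exact good48 χ hquad hprim σ hσ0 hσ1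
  · exact good49 χ hquad hprim σ hσ0 hσ1
  · exact good_two_mul (m := 25) (by decide) χ hquad hprim σ hσ0 hσ1
  · exact good_of_jacobi_two (q := 51) (by decide) (by norm_num)
      [0, 1, -1, 0, 1, 1, 0, -1, -1, 0, -1, 1, 0, 1, 1, 0, 1, 0, 0, 1, 1, 0, -1, 1, 0, 1, -1, 0, -1, 1, 0, -1, -1, 0, 0, -1, 0, -1, -1, 0, -1, 1, 0, 1, 1, 0, -1, -1, 0, 1, -1] rfl
      (by intro k hk; interval_cases k <;> norm_num <;> decide) (by decide) (by decide) (by decide)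
      χ hquad hprim σ hσ0 hσ1
  · exact good52 χ hquad hprim σ hσ0 hσ1

/-- **`NoExceptionalZeroUpTo 52 c` for every `c`, unconditionally** — a named-fact-free base table for
certificates indexed by larger discriminants. [cite: MontgomeryVaughan2007, §11.2.1 Exercise 7] -/
theorem noExceptionalZeroUpTo_fiftyTwo (c : ℝ) : NoExceptionalZeroUpTo 52 c :=
  noRealZeroUpTo_fiftyTwo.noExceptionalZeroUpTo c

end Literature.NumberTheory.LFunctions
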